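import Mathlib
import HarnessLib
import Summits.ABC.ABC.Theses.CongruentialReceptacle
import Summits.ABC.ABC.Theorems.CongruentialReceptacleCompactBalanceTransferPowerDeep
import Summits.ABC.ABC.Theorems.FeketeScalesSubmultOfRST

/-!
# Crux `CompactBalanceTransfer` (stmt-ABC-1725) — what `H` certifies: balanced witnesses

Support file (`--supports stmt-ABC-1725`) of the line lead `prover-line-stmt-ABC-1725-c11-0` (2026-08-17), line `birth`.

`H := ∀ κ > 0, ∀ ε > 0, ∃ C, ∀ abc-triples with κc ≤ a, κc ≤ b : c < C·rad(abc)^(1+ε)` (abc on every compactly balanced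
cell) is the hypothesis of the crux `CompactBalanceTransfer := H → ABC`. Every use of `H` toward an arbitrary (deep)
abc-triple `T = (a,b,c)` applies `H` to some balanced triple `T' = (a',b',c')` — a *witness* — and transports the bound.
This file records the EXACT bookkeeping of that transport, once and for all, so that "which deep triples can `H` reach"
becomes a question about the existence of witnesses (census in `Cruxes/CompactBalanceTransfer/Lines/birth-lead-c11.md` §3):

* `abc_of_balancedWitness` — the master form: if `log c ≤ w·log c' + B` and `w·log rad(T') ≤ log rad(T) + B` for some
  `0 ≤ w ≤ W`, then `H(κ, ε)` gives `c < C(κ,ε,W,B)·rad(abc)^(1+ε)`.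
* `abc_of_qualityWitness` — the scale-free instance (`B = 0`, `w = log c / log c'`): a `κ`-balanced triple of HEIGHT
  `≥ (log c)/W` and QUALITY `≥ quality(T)` certifies `T`. No relation between the supports of `T` and `T'` is needed: what `H`
  certifies with constants `(κ, W)` is exactly the set of triples dominated in (quality, height/W) by a `κ`-balanced one —
  the pointwise form of "quality-preserving balancing" (`compactBalanceTransfer_of_qualityBalancing`, census S1).
* `abc_of_dominatedCompanion` — the constructive instance used by all teeth and companions (`w = 1`): `c ≤ M·c'` and
  `rad(T') ≤ t·rad(T)` (e.g. `supp T' ⊆ supp T ∪ {toll primes}`); generalises `FirstTooth.lt_of_balanced_partner` (`M`-free,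
  `t = 1` there) to a height window `M` and a toll `t`.

All statements spelled out (no `def`s); unconditional; standard axioms; no named facts. [folklore]
-/

-- `Summit.<Summit>.<Problem>`: for the single-conjunct summit `ABC` the duplicate `ABC.ABC` is mandated.
set_option linter.dupNamespace false

namespace Summit.ABC.ABC.Theorems.CompactBalanceTransfer.QualityWitness

open Literature.NumberTheory.DiophantineGeometry

/-! ## Positivity bookkeeping for abc-triples -/

/-- For an abc-triple, `2 ≤ c`. [folklore] -/
theorem two_le_c {a b c : ℕ} (h : IsABCTriple a b c) : 2 ≤ c := by
  obtain ⟨ha, hb, hsum, _⟩ := h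
  omega

-- Reused from the tree: `PowerDeep.rad_pos_nat : 0 < rad a b c` (p138328) and
-- `SubmultOfRST.two_le_rad : IsABCTriple a b c → 2 ≤ rad a b c` (FeketeScalesSubmultOfRST).

/-! ## The master transport lemma -/

/-- **What `H` certifies (master form).** Under `H`, for all `κ, ε > 0` and all reals `W, B` there is `C > 0` such that:
whenever an abc-triple `(a,b,c)` admits a `κ`-balanced abc-triple `(a',b',c')` and a weight `0 ≤ w ≤ W` with
`log c ≤ w·log c' + B` (height domination) and `w·log rad(a'b'c') ≤ log rad(abc) + B` (radical domination), then
`c < C·rad(abc)^(1+ε)`. Proof: `H` gives `log c' < log K + (1+ε)·log rad'` with `K ≥ 1`; multiply by `w` and chain: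
`log c ≤ W·log K + (1+ε)(log rad + B) + B`. [folklore] -/
theorem abc_of_balancedWitness
    (hH : ∀ κ : ℝ, 0 < κ → ∀ ε : ℝ, 0 < ε → ∃ C : ℝ, ∀ a b c : ℕ, IsABCTriple a b c →
      κ * (c : ℝ) ≤ (a : ℝ) → κ * (c : ℝ) ≤ (b : ℝ) → (c : ℝ) < C * ((rad a b c : ℕ) : ℝ) ^ (1 + ε))
    {κ ε : ℝ} (W B : ℝ) (hκ : 0 < κ) (hε : 0 < ε) :
    ∃ C : ℝ, 0 < C ∧ ∀ a b c a' b' c' : ℕ, IsABCTriple a b c → IsABCTriple a' b' c' →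
      κ * (c' : ℝ) ≤ (a' : ℝ) → κ * (c' : ℝ) ≤ (b' : ℝ) →
      (∃ w : ℝ, 0 ≤ w ∧ w ≤ W ∧ Real.log (c : ℝ) ≤ w * Real.log (c' : ℝ) + B ∧
          w * Real.log ((rad a' b' c' : ℕ) : ℝ) ≤ Real.log ((rad a b c : ℕ) : ℝ) + B) →
        (c : ℝ) < C * ((rad a b c : ℕ) : ℝ) ^ (1 + ε) := by
  obtain ⟨K, hK⟩ := hH κ hκ ε hε
  -- normalised constant K₁ ≥ 1
  set K₁ : ℝ := max K 1 with hK₁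
  have hK₁one : (1 : ℝ) ≤ K₁ := le_max_right _ _
  have hK₁pos : (0 : ℝ) < K₁ := lt_of_lt_of_le one_pos hK₁one
  have hlogK₁ : 0 ≤ Real.log K₁ := Real.log_nonneg hK₁one
  have h1ε : (0 : ℝ) < 1 + ε := by linarith
  refine ⟨2 * (K₁ ^ W * Real.exp ((1 + ε) * B + B)), by positivity, ?_⟩
  rintro a b c a' b' c' habc habc' ha' hb' ⟨w, hw0, hwW, hheight, hradical⟩
  -- positivity of the data
  have hcpos : (0 : ℝ) < (c : ℝ) := by exact_mod_cast lt_of_lt_of_le (by norm_num) (two_le_c habc)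
  have hc'pos : (0 : ℝ) < (c' : ℝ) := by exact_mod_cast lt_of_lt_of_le (by norm_num) (two_le_c habc')
  have hRpos : (0 : ℝ) < ((rad a b c : ℕ) : ℝ) := by exact_mod_cast PowerDeep.rad_pos_nat a b c
  have hR'pos : (0 : ℝ) < ((rad a' b' c' : ℕ) : ℝ) := by exact_mod_cast PowerDeep.rad_pos_nat a' b' c'
  set L := Real.log (c : ℝ) with hL
  set L' := Real.log (c' : ℝ) with hL'
  set R := Real.log ((rad a b c : ℕ) : ℝ) with hR
  set R' := Real.log ((rad a' b' c' : ℕ) : ℝ) with hR'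
  have hR'nn : 0 ≤ R' := Real.log_nonneg (by exact_mod_cast (PowerDeep.rad_pos_nat a' b' c'))
  -- `H` on the witness, in logarithms: L' < log K₁ + (1+ε) R'
  have hX : (0 : ℝ) < ((rad a' b' c' : ℕ) : ℝ) ^ (1 + ε) := Real.rpow_pos_of_pos hR'pos _
  have hlt : (c' : ℝ) < K₁ * ((rad a' b' c' : ℕ) : ℝ) ^ (1 + ε) :=
    lt_of_lt_of_le (hK a' b' c' habc' ha' hb') (mul_le_mul_of_nonneg_right (le_max_left _ _) hX.le)
  have hlogH : L' < Real.log K₁ + (1 + ε) * R' := by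
    have := Real.log_lt_log hc'pos hlt
    rwa [Real.log_mul hK₁pos.ne' hX.ne', Real.log_rpow hR'pos] at this
  -- chain the inequalities
  have h1 : w * L' ≤ w * Real.log K₁ + (1 + ε) * (w * R') := by
    have := mul_le_mul_of_nonneg_left hlogH.le hw0
    linarith [this]
  have h2 : w * Real.log K₁ ≤ W * Real.log K₁ := mul_le_mul_of_nonneg_right hwW hlogK₁
  have h3 : (1 + ε) * (w * R') ≤ (1 + ε) * (R + B) := mul_le_mul_of_nonneg_left hradical h1ε.le
  have hmain : L ≤ W * Real.log K₁ + ((1 + ε) * B + B) + (1 + ε) * R := by linarith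
  -- exponentiate
  have hexp : (c : ℝ) ≤ K₁ ^ W * Real.exp ((1 + ε) * B + B) * ((rad a b c : ℕ) : ℝ) ^ (1 + ε) := by
    have e1 : (c : ℝ) = Real.exp L := by rw [hL, Real.exp_log hcpos]
    have e2 : K₁ ^ W = Real.exp (W * Real.log K₁) := by
      rw [Real.rpow_def_of_pos hK₁pos, mul_comm]
    have e3 : ((rad a b c : ℕ) : ℝ) ^ (1 + ε) = Real.exp ((1 + ε) * R) := by
      rw [Real.rpow_def_of_pos hRpos, hR, mul_comm]
    rw [e1, e2, e3, ← Real.exp_add, ← Real.exp_add]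
    exact Real.exp_le_exp.mpr hmain
  have hpos : 0 < K₁ ^ W * Real.exp ((1 + ε) * B + B) * ((rad a b c : ℕ) : ℝ) ^ (1 + ε) := by
    have : (0 : ℝ) < ((rad a b c : ℕ) : ℝ) ^ (1 + ε) := Real.rpow_pos_of_pos hRpos _
    positivity
  calc (c : ℝ) ≤ K₁ ^ W * Real.exp ((1 + ε) * B + B) * ((rad a b c : ℕ) : ℝ) ^ (1 + ε) := hexp
    _ < 2 * (K₁ ^ W * Real.exp ((1 + ε) * B + B) * ((rad a b c : ℕ) : ℝ) ^ (1 + ε)) := by linarith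
    _ = 2 * (K₁ ^ W * Real.exp ((1 + ε) * B + B)) * ((rad a b c : ℕ) : ℝ) ^ (1 + ε) := by ring

/-! ## Scale-free instance: quality witnesses -/

/-- **Quality witnesses.** Under `H`, for all `κ, ε > 0` and every real `W` there is `C > 0` such that every abc-triple
`(a,b,c)` which is dominated by some `κ`-balanced abc-triple `(a',b',c')` in HEIGHT (`log c ≤ W·log c'`) and in
QUALITY (`quality(a,b,c) ≤ quality(a',b',c')`, i.e. `log c / log rad(abc) ≤ log c' / log rad(a'b'c')`) satisfies
`c < C·rad(abc)^(1+ε)`. No relation between the prime supports is required. (Take `w := log c / log c'`.) [folklore] -/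
theorem abc_of_qualityWitness :
    (∀ κ : ℝ, 0 < κ → ∀ ε : ℝ, 0 < ε → ∃ C : ℝ, ∀ a b c : ℕ, IsABCTriple a b c →
      κ * (c : ℝ) ≤ (a : ℝ) → κ * (c : ℝ) ≤ (b : ℝ) → (c : ℝ) < C * ((rad a b c : ℕ) : ℝ) ^ (1 + ε)) →
    ∀ κ : ℝ, 0 < κ → ∀ ε : ℝ, 0 < ε → ∀ W : ℝ, ∃ C : ℝ, 0 < C ∧
      ∀ a b c a' b' c' : ℕ, IsABCTriple a b c → IsABCTriple a' b' c' →
        κ * (c' : ℝ) ≤ (a' : ℝ) → κ * (c' : ℝ) ≤ (b' : ℝ) →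
        Real.log (c : ℝ) ≤ W * Real.log (c' : ℝ) → quality a b c ≤ quality a' b' c' →
          (c : ℝ) < C * ((rad a b c : ℕ) : ℝ) ^ (1 + ε) := by
  intro hH κ hκ ε hε W
  obtain ⟨C, hC, h⟩ := abc_of_balancedWitness hH W 0 hκ hε
  refine ⟨C, hC, fun a b c a' b' c' habc habc' ha' hb' hheight hq => h a b c a' b' c' habc habc' ha' hb' ?_⟩
  have hc'1 : (1 : ℝ) < (c' : ℝ) := by exact_mod_cast lt_of_lt_of_le (by norm_num) (two_le_c habc')
  have hc1 : (1 : ℝ) < (c : ℝ) := by exact_mod_cast lt_of_lt_of_le (by norm_num) (two_le_c habc)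
  have hL'pos : 0 < Real.log (c' : ℝ) := Real.log_pos hc'1
  have hLpos : 0 < Real.log (c : ℝ) := Real.log_pos hc1
  have hRpos : 0 < Real.log ((rad a b c : ℕ) : ℝ) :=
    Real.log_pos (by exact_mod_cast lt_of_lt_of_le (by norm_num) (SubmultOfRST.two_le_rad habc))
  have hR'pos : 0 < Real.log ((rad a' b' c' : ℕ) : ℝ) :=
    Real.log_pos (by exact_mod_cast lt_of_lt_of_le (by norm_num) (SubmultOfRST.two_le_rad habc'))
  refine ⟨Real.log (c : ℝ) / Real.log (c' : ℝ), by positivity, ?_, ?_, ?_⟩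
  · rwa [div_le_iff₀ hL'pos]
  · rw [div_mul_cancel₀ _ hL'pos.ne']; simp
  · -- quality comparison: (log c / log c') · log rad' ≤ log rad
    rw [quality, quality, div_le_div_iff₀ hRpos hR'pos] at hq
    rw [add_zero, div_mul_eq_mul_div, div_le_iff₀ hL'pos]
    linarith [hq]

/-! ## Constructive instance: dominated companions (teeth, S-unit companions) -/

/-- **Dominated companions.** Under `H`, for all `κ, ε > 0`, `M ≥ 1`, `t ≥ 1` there is `C > 0` such that every abc-triple
`(a,b,c)` admitting a `κ`-balanced abc-triple `(a',b',c')` with `c ≤ M·c'` (comparable height) and `rad(a'b'c') ≤ t·rad(abc)`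
(radical dominated up to the toll `t`, e.g. `supp(a'b'c') ⊆ supp(abc) ∪ {primes of t}`) satisfies `c < C·rad(abc)^(1+ε)`.
This is the transfer behind every tooth/companion (`FirstTooth.lt_of_balanced_partner` is `t = 1`). (Take `w := 1`,
`B := log M + log t`.) [folklore] -/
theorem abc_of_dominatedCompanion
    (hH : ∀ κ : ℝ, 0 < κ → ∀ ε : ℝ, 0 < ε → ∃ C : ℝ, ∀ a b c : ℕ, IsABCTriple a b c →
      κ * (c : ℝ) ≤ (a : ℝ) → κ * (c : ℝ) ≤ (b : ℝ) → (c : ℝ) < C * ((rad a b c : ℕ) : ℝ) ^ (1 + ε))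
    {κ ε M t : ℝ} (hκ : 0 < κ) (hε : 0 < ε) (hM : 1 ≤ M) (ht : 1 ≤ t) :
    ∃ C : ℝ, 0 < C ∧ ∀ a b c a' b' c' : ℕ, IsABCTriple a b c → IsABCTriple a' b' c' →
      κ * (c' : ℝ) ≤ (a' : ℝ) → κ * (c' : ℝ) ≤ (b' : ℝ) →
      (c : ℝ) ≤ M * (c' : ℝ) → ((rad a' b' c' : ℕ) : ℝ) ≤ t * ((rad a b c : ℕ) : ℝ) →
        (c : ℝ) < C * ((rad a b c : ℕ) : ℝ) ^ (1 + ε) := by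
  obtain ⟨C, hC, h⟩ := abc_of_balancedWitness hH 1 (Real.log M + Real.log t) hκ hε
  refine ⟨C, hC, fun a b c a' b' c' habc habc' ha' hb' hheight hrad => h a b c a' b' c' habc habc' ha' hb' ?_⟩
  have hcpos : (0 : ℝ) < (c : ℝ) := by exact_mod_cast lt_of_lt_of_le (by norm_num) (two_le_c habc)
  have hc'pos : (0 : ℝ) < (c' : ℝ) := by exact_mod_cast lt_of_lt_of_le (by norm_num) (two_le_c habc')
  have hRpos : (0 : ℝ) < ((rad a b c : ℕ) : ℝ) := by exact_mod_cast PowerDeep.rad_pos_nat a b c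
  have hR'pos : (0 : ℝ) < ((rad a' b' c' : ℕ) : ℝ) := by exact_mod_cast PowerDeep.rad_pos_nat a' b' c'
  have hMpos : (0 : ℝ) < M := lt_of_lt_of_le one_pos hM
  have htpos : (0 : ℝ) < t := lt_of_lt_of_le one_pos ht
  refine ⟨1, zero_le_one, le_rfl, ?_, ?_⟩
  · have := Real.log_le_log hcpos hheight
    rw [Real.log_mul hMpos.ne' hc'pos.ne'] at this
    linarith [Real.log_nonneg ht]
  · have := Real.log_le_log hR'pos hrad
    rw [Real.log_mul htpos.ne' hRpos.ne'] at this
    linarith [Real.log_nonneg hM]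

end Summit.ABC.ABC.Theorems.CompactBalanceTransfer.QualityWitness
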